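import Summits.ValiantsHypothesis.ValiantsHypothesis.Theorems.DivisionGapPerDivisionHardStubDescent

/-!
# Crux `DivisionGap.PerDivisionHard` (stmt-ValiantsHypothesis-5065), line
`pair-descent-jss-endpoint` — stub `stub_fibreBackground` (canonical background split of the
projected fibre)

For a placement `eR eC : BlockV b k m ≃ Fin n` of the block arsenal `G(b,k) ⊕ M₀` with `k ≥ 1`
and a weight `w` whose top fibre `top_w h` AGREES off the placed face `G = placedBlock eR eC`
(any two of its monomials have the same multiplicity in every cell outside `G`), the phase
projection `P = aeval (blockSubst eR eC)` splits the projected fibre canonically: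

  `P (top_w h) = x^{U₀} · F`,  `supp F = { T d : d ∈ supp (top_w h) }`,

where `T d (i, j) = d (hub (i, j))` is the HUB TABLE of `d` — its multiplicities in the hubs
`hub (i, j) = (eR (inl i), eC (inr (inl (i, j, 0))))`, the first cells of the subdivision paths —
and `U₀` is one background exponent.

* `P` sends the monomial `c x^d` to the monomial `c x^{Φ d}`, `Φ d = Σ_e d e • s e`, where a cell
  `e` of the core row `eR (inl i)` contributes `s e = e_{(i, phase of its column label)}`
  (`labelSubst`, `phaseIdx`) and every other cell contributes `s e = 0`;
* the hub `hub (i, j)` has phase `j`, so the hubs contribute exactly the hub table `T d`;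
* for `k ≥ 1` the core row label `inl i` is `blockAdj`-adjacent ONLY to the column labels
  `inr (inl (i, j, 0))` of its hubs, so every non-hub cell of a core row lies OFF the placed face
  and, by the agreement hypothesis, has the same multiplicity in every fibre monomial: the non-hub
  cells contribute the same background `U₀` for every `d` in the fibre;
* hence `P (top_w h) = Σ_d c_d x^{U₀ + T d} = x^{U₀} · F` with `F = Σ_d c_d x^{T d}`
  (`monomial_mul`, `Finset.mul_sum`), and over `ℝ≥0` nothing cancels, so `supp F` is the image
  of the fibre under `T` (cf. the monomial formula of `Theorems/…StubDescent.lean`).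
-/

noncomputable section

-- `Summit.ValiantsHypothesis.ValiantsHypothesis.…` is the tree's mandated single-conjunct layout
-- (Sub = Summit), so the duplicated namespace component is intended.
set_option linter.dupNamespace false

namespace Summit.ValiantsHypothesis.ValiantsHypothesis.Theorems.DivisionGapPerDivisionHard

open MvPolynomial Literature.Computability.AlgebraicComplexity
open Summit.ValiantsHypothesis.ValiantsHypothesis.Theorems.ZeroOneTransfer.Negative
open scoped NNReal

variable {b k m n : ℕ}

/-! ### The phase projection on monomials -/

/-- Every value of `blockSubst` is a monic monomial: the cell `e` of the core row `eR (inl i)`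
goes to `X (i, phase of its column label)`, every other cell to `1`. [folklore] -/
private theorem fibreBackground_aux_blockSubst_eq (eR eC : BlockV b k m ≃ Fin n)
    (e : Fin n × Fin n) :
    blockSubst eR eC e =
      monomial (Sum.elim (fun i : Fin b => Finsupp.single (i, phaseIdx i (eC.symm e.2)) 1)
        (fun _ => 0) (eR.symm e.1)) 1 := by
  unfold blockSubst
  generalize eR.symm e.1 = r
  rcases r with i | y
  · simp only [Sum.elim_inl]
    rfl
  · simp only [Sum.elim_inr, ← C_apply, C_1]
    rfl

/-- Under a substitution by monic monomials, the monomial `c x^d` goes to the monomial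
`c x^{Σ_i d_i • s_i}`. [folklore] -/
private theorem fibreBackground_aux_aeval_monomial {σ τ R : Type*} [Fintype σ] [CommSemiring R]
    {a : σ → MvPolynomial τ R} {s : σ → τ →₀ ℕ} (hs : ∀ i, a i = monomial (s i) 1)
    (d : σ →₀ ℕ) (c : R) :
    aeval a (monomial d c) = monomial (∑ i, d i • s i) c := by
  rw [aeval_monomial, algebraMap_eq, Finsupp.prod_pow, monomial_sum_index]
  congr 1
  refine Finset.prod_congr rfl fun i _ => ?_
  rw [hs i, monomial_pow, one_pow]

/-- `Σ_a f a • e_a` is the finitely supported function with values `f`. [folklore] -/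
private theorem fibreBackground_aux_sum_smul_single {α : Type*} [Fintype α] (f : α → ℕ) :
    ∑ a, f a • Finsupp.single a (1 : ℕ) = Finsupp.equivFunOnFinite.symm f := by
  rw [Finsupp.equivFunOnFinite_symm_eq_sum]
  exact Finset.sum_congr rfl fun a _ => Finsupp.smul_single_one a (f a)

/-! ### A core row meets the placed face only in its hubs -/

/-- For `k ≥ 1`, a cell of the core row `eR (inl i)` other than the hubs
`(eR (inl i), eC (inr (inl (i, j, 0))))` lies off the placed face: the row label `inl i` is
adjacent only to the column labels `inr (inl (i, j, 0))`. [folklore] -/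
private theorem fibreBackground_aux_not_mem_placedBlock (eR eC : BlockV b k m ≃ Fin n)
    (hk : 0 < k) {e : Fin n × Fin n} {i : Fin b} (hi : eR.symm e.1 = Sum.inl i)
    (hne : ∀ j : Fin b, e ≠ (eR (Sum.inl i), eC (Sum.inr (Sum.inl (i, j, ⟨0, hk⟩))))) :
    e ∉ placedBlock eR eC := by
  intro he
  simp only [placedBlock, Finset.mem_filter, Finset.mem_univ, true_and] at he
  rw [hi] at he
  generalize hℓ : eC.symm e.2 = ℓ at he
  rcases ℓ with j | ⟨i', j', t⟩ | u
  · simp only [blockAdj, decide_eq_true_eq] at he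
    omega
  · simp only [blockAdj, decide_eq_true_eq] at he
    obtain ⟨rfl, ht⟩ := he
    refine hne j' (Prod.ext (eR.symm_apply_eq.mp hi) ?_)
    rw [Equiv.symm_apply_eq] at hℓ
    rw [hℓ, show t = ⟨0, hk⟩ from Fin.ext ht]
  · simp [blockAdj] at he

/-! ### The stub -/

/-- **`stub_fibreBackground` (canonical background split of the projected fibre, line
`pair-descent-jss-endpoint`).**  For `k ≥ 1` and a weight whose top fibre agrees off the placed
face, `aeval (blockSubst eR eC) (top_w h) = x^{U₀} · F` for some background `U₀` and some `F`
whose support is exactly the set of hub tables of the fibre monomials.  (Every cell of the core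
row `eR (inl i)` projects into row `i`: the hub `(eR (inl i), eC (inr (inl (i,j,0))))` to
`X (i, j)` with its own multiplicity, every other cell of that row is off the face — a core row is
adjacent only to its hubs when `k ≥ 1` — hence carries the same multiplicity in every fibre
monomial and goes into `U₀`; non-core rows project to `1`.  Over `ℝ≥0` nothing cancels, so
supports are images.) [folklore] -/
theorem stub_fibreBackground :
    ∀ (b k m n : ℕ) (eR eC : BlockV b k m ≃ Fin n) (w : Fin n × Fin n → ℕ)
      (h : MvPolynomial (Fin n × Fin n) ℝ≥0) (hk : 0 < k),
      (∀ m₁ ∈ (topComponent w h).support, ∀ m₂ ∈ (topComponent w h).support,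
        ∀ e ∉ placedBlock eR eC, m₁ e = m₂ e) →
      ∃ (U₀ : (Fin b × Fin b) →₀ ℕ) (F : MvPolynomial (Fin b × Fin b) ℝ≥0),
        aeval (blockSubst eR eC) (topComponent w h) = monomial U₀ 1 * F ∧
        F.support = (topComponent w h).support.image fun d =>
          Finsupp.equivFunOnFinite.symm fun ij : Fin b × Fin b =>
            d (eR (Sum.inl ij.1), eC (Sum.inr (Sum.inl (ij.1, ij.2, ⟨0, hk⟩)))) := by
  intro b k m n eR eC w h hk hagree
  classical
  -- the empty fibre: both sides vanish
  by_cases h0 : topComponent w h = 0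
  · refine ⟨0, 0, ?_, ?_⟩
    · rw [h0, map_zero, mul_zero]
    · simp [h0]
  obtain ⟨d₀, hd₀⟩ := support_nonempty.mpr h0
  set p := topComponent w h
  -- the hubs and the hub table `T d` of an exponent `d`
  set hub : Fin b × Fin b → Fin n × Fin n :=
    fun ij => (eR (Sum.inl ij.1), eC (Sum.inr (Sum.inl (ij.1, ij.2, ⟨0, hk⟩)))) with hhub
  set T : ((Fin n × Fin n) →₀ ℕ) → (Fin b × Fin b) →₀ ℕ :=
    fun d => Finsupp.equivFunOnFinite.symm fun ij : Fin b × Fin b =>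
      d (eR (Sum.inl ij.1), eC (Sum.inr (Sum.inl (ij.1, ij.2, ⟨0, hk⟩))))
  show ∃ (U₀ : (Fin b × Fin b) →₀ ℕ) (F : MvPolynomial (Fin b × Fin b) ℝ≥0),
    aeval (blockSubst eR eC) p = monomial U₀ 1 * F ∧ F.support = p.support.image T
  -- the exponent `s e` of the image of the cell `e`, and the exponent `Φ d` of the image of `x^d`
  set s : Fin n × Fin n → (Fin b × Fin b) →₀ ℕ := fun e =>
    Sum.elim (fun i : Fin b => Finsupp.single (i, phaseIdx i (eC.symm e.2)) 1) (fun _ => 0)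
      (eR.symm e.1) with hs_def
  have hs : ∀ e, blockSubst eR eC e = monomial (s e) 1 :=
    fun e => fibreBackground_aux_blockSubst_eq eR eC e
  set Φ : ((Fin n × Fin n) →₀ ℕ) → (Fin b × Fin b) →₀ ℕ := fun d => ∑ e, d e • s e
  have hsum : aeval (blockSubst eR eC) p = ∑ d ∈ p.support, monomial (Φ d) (coeff d p) := by
    conv_lhs => rw [p.as_sum]
    rw [map_sum]
    exact Finset.sum_congr rfl fun d _ => fibreBackground_aux_aeval_monomial hs d _
  -- the hubs contribute the hub table
  have hub_inj : ∀ x y, hub x = hub y → x = y := by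
    rintro ⟨i, j⟩ ⟨i', j'⟩ hxy
    simp only [hhub, Prod.mk.injEq, EmbeddingLike.apply_eq_iff_eq, Sum.inl.injEq,
      Sum.inr.injEq] at hxy
    exact Prod.ext hxy.1 hxy.2.2.1
  have s_hub : ∀ ij, s (hub ij) = Finsupp.single ij 1 := by
    rintro ⟨i, j⟩
    simp [hs_def, hhub, phaseIdx]
  have hhubs : ∀ d : (Fin n × Fin n) →₀ ℕ, ∑ e ∈ Finset.univ.image hub, d e • s e = T d := by
    intro d
    rw [Finset.sum_image fun x _ y _ hxy => hub_inj x y hxy]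
    simp_rw [s_hub]
    exact fibreBackground_aux_sum_smul_single fun ij => d (hub ij)
  -- the non-hub cells contribute the same background for every fibre monomial
  set U₀ : (Fin b × Fin b) →₀ ℕ := ∑ e ∈ (Finset.univ.image hub)ᶜ, d₀ e • s e
  have hbg : ∀ d ∈ p.support, ∑ e ∈ (Finset.univ.image hub)ᶜ, d e • s e = U₀ := by
    intro d hd
    refine Finset.sum_congr rfl fun e he => ?_
    rcases hr : eR.symm e.1 with i | y
    · have hoff : e ∉ placedBlock eR eC :=
        fibreBackground_aux_not_mem_placedBlock eR eC hk hr fun j hej =>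
          (Finset.mem_compl.mp he)
            (Finset.mem_image.mpr ⟨(i, j), Finset.mem_univ _, hej.symm⟩)
      rw [hagree d hd d₀ hd₀ e hoff]
    · simp only [hs_def, hr, Sum.elim_inr, smul_zero]
  have hΦ : ∀ d ∈ p.support, Φ d = U₀ + T d := by
    intro d hd
    show ∑ e, d e • s e = U₀ + T d
    rw [← Finset.sum_compl_add_sum (Finset.univ.image hub), hbg d hd, hhubs d]
  -- the split `P (top_w h) = x^{U₀} · F`, `F = Σ_d c_d x^{T d}`
  refine ⟨U₀, ∑ d ∈ p.support, monomial (T d) (coeff d p), ?_, ?_⟩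
  · rw [hsum, Finset.mul_sum]
    refine Finset.sum_congr rfl fun d hd => ?_
    rw [hΦ d hd, monomial_mul, one_mul]
  · apply Finset.Subset.antisymm
    · intro x hx
      obtain ⟨d, hd, hxd⟩ := Finset.mem_biUnion.mp (support_sum hx)
      exact Finset.mem_image.mpr
        ⟨d, hd, (Finset.mem_singleton.mp (support_monomial_subset hxd)).symm⟩
    · intro x hx
      obtain ⟨d₁, hd₁, rfl⟩ := Finset.mem_image.mp hx
      rw [mem_support_iff, coeff_sum]
      intro hc
      have hle : coeff (T d₁) (monomial (T d₁) (coeff d₁ p)) ≤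
          ∑ d ∈ p.support, coeff (T d₁) (monomial (T d) (coeff d p)) :=
        Finset.single_le_sum_of_canonicallyOrdered
          (f := fun d => coeff (T d₁) (monomial (T d) (coeff d p))) hd₁
      rw [hc, coeff_monomial, if_pos rfl, nonpos_iff_eq_zero] at hle
      exact (mem_support_iff.mp hd₁) hle

end Summit.ValiantsHypothesis.ValiantsHypothesis.Theorems.DivisionGapPerDivisionHard

end
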